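import Summits.ValiantsHypothesis.ValiantsHypothesis.Theorems.KPlusLogSqLawOctaveDefs
import Summits.ValiantsHypothesis.ValiantsHypothesis.Theorems.KPlusLogSqLawTropicalBSplitDefs

/-!
# Route «KPlusLogSqLaw», octave line — file 4/7: cancellation DEPTH, the rung `ShallowOctaveLifting` (defined), the atoms `rawConfinement` / `envelopeGap`, raw Leibniz terms, design breakpoints, the three pieces and their composition

HONEST FRAMING.  Octave line of ideator seat val-idea-6 (crux-idea `octave-lifting` on stmt-ValiantsHypothesis-19561, critic-1 PASS 2026-08-27), published as `Cruxes/WeakLifting/Lines/octave.lean`; landed in Theorems shape by prover seat val-width-19561-oc1 (`--supports stmt-ValiantsHypothesis-19561`).  Conjecture B (`KPlusLogSqLaw`), `TropicalB` (stmt-19771), `WeakLifting` (stmt-19561), `MatrixDescartes` (stmt-18050) and the octave statements `OctaveWeakLifting` / `OctaveKLaw` / `OctaveMatrixDescartes` are OPEN and DEFINED, never asserted; nothing in this file proves any of them, and VP ≠ VNP is not moved.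

This file: `DepthLE`, `ShallowOctaveLifting` (def), `rawConfinement`, `envelopeGap`, `RawTerm`, `rawCoef`, `rawSlope`, `rawLog`, `rawCross`, `designBreaks`, `DesignPiecesBound`, `rawLine`, `RealChainBound`, `RootNearBreakpoint`, `CellCount`, `shallowOctaveLifting_of` (kernel composition).  The pieces are PROVED in files 5–6 and assembled in file 7.
-/

set_option linter.dupNamespace false
set_option autoImplicit false

namespace Summit.ValiantsHypothesis.ValiantsHypothesis.Theorems.KPlusLogSqLaw.Octave

open Polynomial Finset
open scoped BigOperators
open Summit.ValiantsHypothesis.ValiantsHypothesis.Theorems.LacunarySymmetroidMatrixDescartes (RealRootLawAt KPlusLogSqLaw)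
open Summit.ValiantsHypothesis.ValiantsHypothesis.Theses.LacunarySymmetroid (MatrixDescartes PencilTransfer ThetaWitness)
open Summit.ValiantsHypothesis.ValiantsHypothesis.Theses.KPlusLogSqLaw (TropicalB WeakLifting)

/-! ## Toward the crux: cancellation DEPTH and the shallow rung (PROVED: `shallowOctaveLifting_proof`) -/

section Depth

open Finset

/-- **cancellation depth ≤ Δ bits.**  Leibniz raw terms of the pencil `Σ_l X^{d l} S_l` are pairs `(σ, λ)` with value
`sign σ · Π_i S_{λ i}(σ i, i)` and slope class `e = Σ_i d(λ i)`; the class sums are the coefficients of `det`.  `DepthLE d S Δ`: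
in every class the sum of absolute values of the raw terms is at most `2^Δ ·|coefficient|` (no dead classes, cancellation
loses at most `Δ` bits).  Integer pencils of height `H` with no dead class have `Δ ≤ log₂ (m! K^m H^m)`. [definition of the seat] -/
def DepthLE {m K : ℕ} (d : Fin K → ℕ) (S : Fin K → Matrix (Fin m) (Fin m) ℝ) (Δ : ℕ) : Prop :=
  ∀ e : ℕ, (∑ σ : Equiv.Perm (Fin m), ∑ lam : Fin m → Fin K,
      (if (∑ i, d (lam i)) = e then ∏ i, |S (lam i) (σ i) i| else 0)) ≤ (2 : ℝ) ^ Δ * |(pencilDet d S).coeff e|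

/-- **Shallow octave lifting** (the line's first RUNG; PROVED below — `shallowOctaveLifting_proof`, 0 sorry — from three named pieces:
`designPiecesBound_proof` = the real→integer design reduction (`realChainBound_proof`, binary tie-breaker + margin), the depth confinement
`rootNearBreakpoint_proof` (raw confinement + envelope gap + Leibniz bookkeeping) and the unit-cell count `cellCount_proof`):
if the unsigned tropical row of format `(m, K)` is `≤ n` (`TropRowD m K n`) then every pencil of that format with
cancellation depth `≤ Δ` has its nonzero real roots in at most `(2 (M + Δ) + 3)(n + 1)` dyadic octaves, `M = m (log₂ (m K) + 1)`
(`≥ log₂` of the number `m! K^m` of raw terms): every root scale lies within `M + Δ` of a breakpoint of the design envelope.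
Symmetry of the `S l` is not even needed.  NOT the crux: `OctaveWeakLifting` is the depth-FREE statement. -/
def ShallowOctaveLifting : Prop :=
  ∀ (m K n Δ : ℕ), Summit.ValiantsHypothesis.ValiantsHypothesis.Theorems.KPlusLogSqLaw.TropRowD m K n →
    ∀ (d : Fin K → ℕ) (S : Fin K → Matrix (Fin m) (Fin m) ℝ), DepthLE d S Δ →
      octaveCount (pencilDet d S) ≤ (2 * (m * (Nat.log 2 (m * K) + 1) + Δ) + 3) * (n + 1)

/-- **atom 1 (raw confinement), PROVED.**  At a positive root of a signed sum of monomials `Σ_τ sgn τ · a τ · x^{s τ}` whose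
equal-exponent classes cancel to depth `≤ Δ` bits, every NONZERO raw term (in particular the largest) is within a factor `#ι · 2^Δ` of a raw term of
ANOTHER class. [folklore] -/
theorem rawConfinement {ι : Type*} [Fintype ι] (s : ι → ℕ) (a : ι → ℝ) (ha : ∀ τ, 0 ≤ a τ) (sgn : ι → ℝ)
    (hsgn : ∀ τ, sgn τ = 1 ∨ sgn τ = -1) (Δ : ℕ)
    (hdepth : ∀ e : ℕ, (∑ τ ∈ univ.filter (fun τ => s τ = e), a τ) ≤
      (2 : ℝ) ^ Δ * |∑ τ ∈ univ.filter (fun τ => s τ = e), sgn τ * a τ|)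
    (x : ℝ) (hx : 0 < x) (hroot : ∑ τ, sgn τ * a τ * x ^ (s τ) = 0) (τ₀ : ι) (ha₀ : 0 < a τ₀) :
    ∃ τ₁, s τ₁ ≠ s τ₀ ∧ a τ₀ * x ^ (s τ₀) ≤ Fintype.card ι * (2 : ℝ) ^ Δ * (a τ₁ * x ^ (s τ₁)) := by
  classical
  have habs : ∀ τ, |sgn τ| = 1 := fun τ => by rcases hsgn τ with h | h <;> simp [h]
  have hsplit : ∑ τ, sgn τ * a τ * x ^ (s τ) =
      x ^ (s τ₀) * (∑ τ ∈ univ.filter (fun τ => s τ = s τ₀), sgn τ * a τ) +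
        ∑ τ ∈ univ.filter (fun τ => ¬ s τ = s τ₀), sgn τ * a τ * x ^ (s τ) := by
    rw [← Finset.sum_filter_add_sum_filter_not univ (fun τ => s τ = s τ₀)]
    congr 1
    rw [Finset.mul_sum]
    refine Finset.sum_congr rfl fun τ hτ => ?_
    rw [(mem_filter.1 hτ).2]; ring
  set C := univ.filter (fun τ => s τ = s τ₀) with hC
  set O := univ.filter (fun τ => ¬ s τ = s τ₀) with hO
  set c := ∑ τ ∈ C, sgn τ * a τ with hc
  have hxpos : 0 < x ^ (s τ₀) := pow_pos hx _
  have hkey : x ^ (s τ₀) * |c| ≤ ∑ τ ∈ O, a τ * x ^ (s τ) := by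
    have h1 : x ^ (s τ₀) * c = -∑ τ ∈ O, sgn τ * a τ * x ^ (s τ) := by linarith [hsplit.symm.trans hroot]
    calc x ^ (s τ₀) * |c| = |x ^ (s τ₀) * c| := by rw [abs_mul, abs_of_pos hxpos]
      _ = |∑ τ ∈ O, sgn τ * a τ * x ^ (s τ)| := by rw [h1, abs_neg]
      _ ≤ ∑ τ ∈ O, |sgn τ * a τ * x ^ (s τ)| := abs_sum_le_sum_abs _ _
      _ = ∑ τ ∈ O, a τ * x ^ (s τ) := Finset.sum_congr rfl fun τ _ => by
          rw [abs_mul, abs_mul, habs, one_mul, abs_of_nonneg (ha τ), abs_of_pos (pow_pos hx _)]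
  have hτ₀C : τ₀ ∈ C := by simp [hC]
  have h1 : a τ₀ ≤ (2 : ℝ) ^ Δ * |c| :=
    (Finset.single_le_sum (f := a) (fun τ _ => ha τ) hτ₀C).trans (hdepth (s τ₀))
  have hO_ne : O.Nonempty := by
    by_contra hemp
    rw [Finset.not_nonempty_iff_eq_empty] at hemp
    have h0 : x ^ (s τ₀) * |c| ≤ 0 := by simpa [hemp] using hkey
    have hcabs : |c| ≤ 0 := by
      by_contra hpos
      push Not at hpos
      have := mul_pos hxpos hpos
      linarith
    have : a τ₀ ≤ 0 := h1.trans (by nlinarith [hcabs, abs_nonneg c, pow_pos (by norm_num : (0:ℝ) < 2) Δ])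
    linarith
  obtain ⟨τ₁, hτ₁O, hmax⟩ := Finset.exists_max_image O (fun τ => a τ * x ^ (s τ)) hO_ne
  refine ⟨τ₁, (mem_filter.1 hτ₁O).2, ?_⟩
  have hpos₁ : 0 ≤ a τ₁ * x ^ (s τ₁) := mul_nonneg (ha τ₁) (pow_pos hx _).le
  have hcard : (O.card : ℝ) ≤ Fintype.card ι := by
    have : O.card ≤ Fintype.card ι := (card_filter_le _ _).trans (Finset.card_univ).le
    exact_mod_cast this
  have hsumO : ∑ τ ∈ O, a τ * x ^ (s τ) ≤ Fintype.card ι * (a τ₁ * x ^ (s τ₁)) :=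
    calc ∑ τ ∈ O, a τ * x ^ (s τ) ≤ ∑ _τ ∈ O, a τ₁ * x ^ (s τ₁) := Finset.sum_le_sum fun τ hτ => hmax τ hτ
      _ = O.card * (a τ₁ * x ^ (s τ₁)) := by rw [Finset.sum_const, nsmul_eq_mul]
      _ ≤ Fintype.card ι * (a τ₁ * x ^ (s τ₁)) := mul_le_mul_of_nonneg_right hcard hpos₁
  calc a τ₀ * x ^ (s τ₀) ≤ (2 : ℝ) ^ Δ * |c| * x ^ (s τ₀) := mul_le_mul_of_nonneg_right h1 hxpos.le
    _ = (2 : ℝ) ^ Δ * (x ^ (s τ₀) * |c|) := by ring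
    _ ≤ (2 : ℝ) ^ Δ * ∑ τ ∈ O, a τ * x ^ (s τ) := mul_le_mul_of_nonneg_left hkey (by positivity)
    _ ≤ (2 : ℝ) ^ Δ * (Fintype.card ι * (a τ₁ * x ^ (s τ₁))) := mul_le_mul_of_nonneg_left hsumO (by positivity)
    _ = Fintype.card ι * (2 : ℝ) ^ Δ * (a τ₁ * x ^ (s τ₁)) := by ring

/-- right-moving half of `envelopeGap`. [folklore] -/
theorem envelopeGap_right {ι : Type*} [Fintype ι] (s : ι → ℤ) (V : ι → ℝ) (c θ : ℝ) (i j : ι) (hij : s i < s j)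
    (htop : ∀ k, V k + s k * θ ≤ V i + s i * θ) (hnear : V i + s i * θ ≤ V j + s j * θ + c) :
    ∃ b : ℝ, θ ≤ b ∧ b ≤ θ + c ∧ ∃ l, s i ≠ s l ∧ V i + s i * b = V l + s l * b ∧
      ∀ t, V t + s t * b ≤ V i + s i * b := by
  classical
  set R := univ.filter (fun k => s i < s k) with hR
  have hjR : j ∈ R := by simp [hR, hij]
  obtain ⟨k₀, hk₀R, hmin⟩ := Finset.exists_min_image R (fun k => (V i - V k) / ((s k : ℝ) - s i)) ⟨j, hjR⟩
  have hk₀ : s i < s k₀ := (mem_filter.1 hk₀R).2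
  have hden : ∀ k, s i < s k → (0 : ℝ) < (s k : ℝ) - s i := fun k hk => by
    have : (s i : ℝ) < s k := by exact_mod_cast hk
    linarith
  have hden1 : ∀ k, s i < s k → (1 : ℝ) ≤ (s k : ℝ) - s i := fun k hk => by
    have h1 : s i + 1 ≤ s k := hk
    have : ((s i : ℝ)) + 1 ≤ s k := by exact_mod_cast h1
    linarith
  have hcross : ∀ k, s i < s k → θ ≤ (V i - V k) / ((s k : ℝ) - s i) := fun k hk => by
    rw [le_div_iff₀ (hden k hk)]
    have := htop k
    nlinarith
  refine ⟨(V i - V k₀) / ((s k₀ : ℝ) - s i), hcross k₀ hk₀, ?_, k₀, hk₀.ne, ?_, ?_⟩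
  · have htj : (V i - V j) / ((s j : ℝ) - s i) ≤ θ + c := by
      rw [div_le_iff₀ (hden j hij)]
      have hc0 : 0 ≤ c := by linarith [htop j]
      have h1 := hden1 j hij
      nlinarith [hnear, hc0, h1]
    exact (hmin j hjR).trans htj
  · have hne : (s k₀ : ℝ) - s i ≠ 0 := (hden k₀ hk₀).ne'
    have : (V i - V k₀) / ((s k₀ : ℝ) - s i) * ((s k₀ : ℝ) - s i) = V i - V k₀ := div_mul_cancel₀ _ hne
    linarith
  · intro t
    by_cases ht : s i < s t
    · have h1 : (V i - V k₀) / ((s k₀ : ℝ) - s i) ≤ (V i - V t) / ((s t : ℝ) - s i) := hmin t (by simp [hR, ht])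
      rw [le_div_iff₀ (hden t ht)] at h1
      linarith
    · push Not at ht
      have hst : (s t : ℝ) ≤ s i := by exact_mod_cast ht
      have hθb : θ ≤ (V i - V k₀) / ((s k₀ : ℝ) - s i) := hcross k₀ hk₀
      have := htop t
      nlinarith [hst, hθb, this]

/-- **atom 2 (envelope geometry), PROVED.**  Lines `θ ↦ V i + s i · θ` with INTEGER slopes: if at `θ` the top line `i` is within
`c` of a line `j` of different slope, then within distance `c` of `θ` there is a breakpoint of the upper envelope (two lines of distinct
slopes tie at the top).  Key: the gap to any line of different slope changes at rate `≥ 1`. [folklore] -/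
theorem envelopeGap {ι : Type*} [Fintype ι] (s : ι → ℤ) (V : ι → ℝ) (c θ : ℝ) (i j : ι) (hij : s i ≠ s j)
    (htop : ∀ k, V k + s k * θ ≤ V i + s i * θ) (hnear : V i + s i * θ ≤ V j + s j * θ + c) :
    ∃ b : ℝ, |θ - b| ≤ c ∧ ∃ k l, s k ≠ s l ∧ V k + s k * b = V l + s l * b ∧ ∀ t, V t + s t * b ≤ V k + s k * b := by
  rcases lt_or_gt_of_ne hij with h | h
  · obtain ⟨b, hθb, hbc, l, hsl, htie, hall⟩ := envelopeGap_right s V c θ i j h htop hnear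
    refine ⟨b, ?_, i, l, hsl, htie, hall⟩
    rw [abs_of_nonpos (by linarith)]
    linarith
  · obtain ⟨b, hθb, hbc, l, hsl, htie, hall⟩ := envelopeGap_right (fun k => -s k) V c (-θ) i j
      (by simpa using h) (fun k => by have := htop k; push_cast; linarith) (by push_cast; linarith)
    refine ⟨-b, ?_, i, l, ?_, ?_, ?_⟩
    · rw [show θ - -b = -(-θ - b) by ring, abs_neg, abs_of_nonpos (by linarith)]
      linarith
    · simpa using hsl
    · push_cast at htie
      linarith
    · intro t
      have := hall t
      push_cast at this
      linarith

/-! ### The rung's plan: three named pieces and their kernel-checked composition -/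

/-- raw Leibniz terms `(σ, λ)` of an `(m, K)` pencil. -/
abbrev RawTerm (m K : ℕ) := Equiv.Perm (Fin m) × (Fin m → Fin K)

variable {m K : ℕ}

/-- signed value of a raw term: `sign σ · Π_i S_{λ i}(σ i, i)`. -/
def rawCoef (S : Fin K → Matrix (Fin m) (Fin m) ℝ) (τ : RawTerm m K) : ℝ :=
  ((Equiv.Perm.sign τ.1 : ℤ) : ℝ) * ∏ i, S (τ.2 i) (τ.1 i) i

/-- slope class of a raw term: `Σ_i d(λ i)`. -/
def rawSlope (d : Fin K → ℕ) (τ : RawTerm m K) : ℕ := ∑ i, d (τ.2 i)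

/-- log-height of a raw term (junk for absent terms, never used there). -/
noncomputable def rawLog (S : Fin K → Matrix (Fin m) (Fin m) ℝ) (τ : RawTerm m K) : ℝ := Real.logb 2 |rawCoef S τ|

/-- crossing abscissa (in `θ = log₂|x|`) of the lines of two raw terms. -/
noncomputable def rawCross (d : Fin K → ℕ) (S : Fin K → Matrix (Fin m) (Fin m) ℝ) (kl : RawTerm m K × RawTerm m K) : ℝ :=
  (rawLog S kl.1 - rawLog S kl.2) / ((rawSlope d kl.2 : ℝ) - rawSlope d kl.1)

open scoped Classical in
/-- **design breakpoints** of the pencil: abscissae where two PRESENT raw lines of distinct slopes tie AT THE TOP of the upper envelope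
`θ ↦ max_{τ present} (rawLog S τ + rawSlope d τ · θ)` (the archimedean tropicalisation of the raw Leibniz expansion — no cancellation seen). -/
noncomputable def designBreaks (d : Fin K → ℕ) (S : Fin K → Matrix (Fin m) (Fin m) ℝ) : Finset ℝ :=
  ((Finset.univ : Finset (RawTerm m K × RawTerm m K)).filter (fun kl =>
      rawCoef S kl.1 ≠ 0 ∧ rawCoef S kl.2 ≠ 0 ∧ rawSlope d kl.1 ≠ rawSlope d kl.2 ∧
        ∀ t : RawTerm m K, rawCoef S t ≠ 0 →
          rawLog S t + rawSlope d t * rawCross d S kl ≤ rawLog S kl.1 + rawSlope d kl.1 * rawCross d S kl)).image (rawCross d S)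

/-- **piece 1 (real → integer design reduction; PROVED as `designPiecesBound_proof`).**  The unsigned tropical row bounds the number of
design breakpoints of every REAL-valued pencil design (sorted breakpoints ⇒ interleaved real chain ⇒ `realChainBound_proof`).
(statement of the line; proved in file 5b) -/
def DesignPiecesBound : Prop :=
  ∀ (m K n : ℕ), Summit.ValiantsHypothesis.ValiantsHypothesis.Theorems.KPlusLogSqLaw.TropRowD m K n →
    ∀ (d : Fin K → ℕ) (S : Fin K → Matrix (Fin m) (Fin m) ℝ), (designBreaks d S).card ≤ n

/-- the raw line of a term in the `θ = log₂|x|` picture. -/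
noncomputable def rawLine (d : Fin K → ℕ) (S : Fin K → Matrix (Fin m) (Fin m) ℝ) (τ : RawTerm m K) (θ : ℝ) : ℝ :=
  rawLog S τ + rawSlope d τ * θ

/-- at the crossing abscissa the two lines agree. -/
theorem rawLine_cross (d : Fin K → ℕ) (S : Fin K → Matrix (Fin m) (Fin m) ℝ) (k l : RawTerm m K)
    (h : rawSlope d k ≠ rawSlope d l) : rawLine d S k (rawCross d S (k, l)) = rawLine d S l (rawCross d S (k, l)) := by
  have hne : (rawSlope d l : ℝ) - rawSlope d k ≠ 0 := by
    rw [sub_ne_zero]; exact_mod_cast (Ne.symm h)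
  rw [rawLine, rawLine, rawCross]
  field_simp
  ring

/-- if two lines of distinct slopes agree at `θ`, their crossing abscissa is `θ`. -/
theorem rawCross_eq_of_tie (d : Fin K → ℕ) (S : Fin K → Matrix (Fin m) (Fin m) ℝ) (k l : RawTerm m K)
    (h : rawSlope d k ≠ rawSlope d l) {θ : ℝ} (htie : rawLine d S k θ = rawLine d S l θ) : rawCross d S (k, l) = θ := by
  have hne : (rawSlope d l : ℝ) - rawSlope d k ≠ 0 := by
    rw [sub_ne_zero]; exact_mod_cast (Ne.symm h)
  rw [rawLine, rawLine] at htie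
  rw [rawCross, div_eq_iff hne]
  linarith

/-- slope comparison: a top term LEFT of a point where `k` is on top has slope `≤` that of `k`. -/
theorem slope_le_of_top_left {d : Fin K → ℕ} {S : Fin K → Matrix (Fin m) (Fin m) ℝ} {t k : RawTerm m K} {θ c : ℝ} (hθc : θ < c)
    (h1 : rawLine d S k θ ≤ rawLine d S t θ) (h2 : rawLine d S t c ≤ rawLine d S k c) : rawSlope d t ≤ rawSlope d k := by
  by_contra hlt
  push Not at hlt
  have hlt' : (rawSlope d k : ℝ) < rawSlope d t := by exact_mod_cast hlt
  simp only [rawLine] at h1 h2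
  nlinarith [mul_pos (sub_pos.2 hlt') (sub_pos.2 hθc)]

/-- slope comparison: a top term RIGHT of a point where `k` is on top has slope `≥` that of `k`. -/
theorem le_slope_of_top_right {d : Fin K → ℕ} {S : Fin K → Matrix (Fin m) (Fin m) ℝ} {t k : RawTerm m K} {θ c : ℝ} (hcθ : c < θ)
    (h1 : rawLine d S k θ ≤ rawLine d S t θ) (h2 : rawLine d S t c ≤ rawLine d S k c) : rawSlope d k ≤ rawSlope d t := by
  by_contra hlt
  push Not at hlt
  have hlt' : (rawSlope d t : ℝ) < rawSlope d k := by exact_mod_cast hlt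
  simp only [rawLine] at h1 h2
  nlinarith [mul_pos (sub_pos.2 hlt') (sub_pos.2 hcθ)]

/-- **piece 1′ (the clean integerisation statement; PROVED as `realChainBound_proof`).**  REAL CHAINS OBEY THE INTEGER TROPICAL ROW:
if `TropRowD m K n`, then for every real pencil design, every chain of `N + 1` points `θ₀ < ⋯ < θ_N` carrying top PRESENT raw terms
`t_j` (maximal raw line at `θ_j`; ties at `θ_j` only inside the slope class of `t_j`) with strictly increasing slope classes has
`N ≤ n`.  PROVED below (`realChainBound_proof`): integer design `v'(e) = −(2^W⌊Q log₂|S_e|⌋ + 2^{idx e})`, `ε'(e) = [S_e ≠ 0]`,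
slopes `θ'_j = 2^W⌊Qθ_j⌋`; all tropical weights are distinct by the binary tie-breaker, so the argmax `p_j` is `IsDominant`; it is
`(m Σd + m + 1)/Q`-top against `t_j` in the real design, hence (margin `μ`, `Q` large) in the slope class of `t_j`; then `DesignRowD`.
(statement of the line, proved in file 5b; technique: rational approximation + lexicographic tie-break, cf. `tropicalB_iff_cardRatDominant`) -/
def RealChainBound : Prop :=
  ∀ (m K n : ℕ), Summit.ValiantsHypothesis.ValiantsHypothesis.Theorems.KPlusLogSqLaw.TropRowD m K n →
    ∀ (d : Fin K → ℕ) (S : Fin K → Matrix (Fin m) (Fin m) ℝ) (N : ℕ) (θ : Fin (N + 1) → ℝ) (t : Fin (N + 1) → RawTerm m K),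
    StrictMono θ → (∀ j, rawCoef S (t j) ≠ 0) →
    (∀ j τ, rawCoef S τ ≠ 0 → rawLine d S τ (θ j) ≤ rawLine d S (t j) (θ j)) →
    (∀ j τ, rawCoef S τ ≠ 0 → rawLine d S τ (θ j) = rawLine d S (t j) (θ j) → rawSlope d τ = rawSlope d (t j)) →
    StrictMono (fun j => rawSlope d (t j)) → N ≤ n

/-- **piece 2 (depth confinement; = `rawConfinement` + `envelopeGap` + the Leibniz bookkeeping `det = Σ_τ rawCoef · X^{rawSlope}`).**
Every nonzero real root of a NONZERO pencil determinant of depth `≤ Δ` has `log₂|x|` within `m(log₂(mK)+1) + Δ` of a design breakpoint. [PROVED: `rootNearBreakpoint_proof`] -/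
def RootNearBreakpoint : Prop :=
  ∀ (m K Δ : ℕ) (d : Fin K → ℕ) (S : Fin K → Matrix (Fin m) (Fin m) ℝ), DepthLE d S Δ →
    ∀ x : ℝ, x ≠ 0 → pencilDet d S ≠ 0 → (pencilDet d S).IsRoot x →
      ∃ b ∈ designBreaks d S, |Real.logb 2 |x| - b| ≤ ((m * (Nat.log 2 (m * K) + 1) + Δ : ℕ) : ℝ)

/-- **piece 3 (unit-cell counting).**  Roots log-confined to `W`-neighbourhoods of a finite set `B` occupy at most `(2W+2)·#B` octaves. [PROVED: `cellCount_proof`] -/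
def CellCount : Prop :=
  ∀ (p : Polynomial ℝ) (B : Finset ℝ) (W : ℕ), (∀ x : ℝ, x ≠ 0 → p ≠ 0 → p.IsRoot x → ∃ b ∈ B, |Real.logb 2 |x| - b| ≤ (W : ℝ)) →
    octaveCount p ≤ (2 * W + 2) * B.card

/-- **the rung from its three pieces** (kernel-checked composition). [folklore] -/
theorem shallowOctaveLifting_of (h1 : DesignPiecesBound) (h2 : RootNearBreakpoint) (h3 : CellCount) : ShallowOctaveLifting := by
  intro m K n Δ hT d S hΔ
  have hB : (designBreaks d S).card ≤ n := h1 m K n hT d S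
  have hW := h3 (pencilDet d S) (designBreaks d S) (m * (Nat.log 2 (m * K) + 1) + Δ)
    (fun x hx hp hr => h2 m K Δ d S hΔ x hx hp hr)
  calc octaveCount (pencilDet d S) ≤ (2 * (m * (Nat.log 2 (m * K) + 1) + Δ) + 2) * (designBreaks d S).card := hW
    _ ≤ (2 * (m * (Nat.log 2 (m * K) + 1) + Δ) + 2) * n := Nat.mul_le_mul_left _ hB
    _ ≤ (2 * (m * (Nat.log 2 (m * K) + 1) + Δ) + 3) * (n + 1) := Nat.mul_le_mul (Nat.le_succ _) (Nat.le_succ _)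

end Depth

end Summit.ValiantsHypothesis.ValiantsHypothesis.Theorems.KPlusLogSqLaw.Octave
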